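import Literature.RepresentationTheory.FiniteGroups.GLnKirillovDimension
import Literature.RepresentationTheory.FiniteGroups.GLnGelfandGraev
import Literature.RepresentationTheory.FiniteGroups.GLnCharacterDegreeBound
import Mathlib.Analysis.SpecialFunctions.Complex.CircleAddChar
import HarnessLib

/-!
# Cuspidal character degrees of `GL_n(𝔽_q)` and the proof of `GreenGLnDegreeBound`

Topic `Literature/RepresentationTheory/FiniteGroups`.

* `GLn.cuspidal_degree_le` — a **cuspidal** irreducible character `σ` of `GL_m(𝔽_q)` has degree
  `σ(1) ≤ (q-1)(q²-1)⋯(q^{m-1}-1)` (in fact `=`, S. I. Gelfand 1970): Kirillov's recursion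
  (`finrank_eq_prod_mul_finrank_whittaker`) and the uniqueness of Whittaker models
  (`finrank_whittaker_tailGroup_le_one`, Gelfand–Graev).
* `GreenGLnDegreeBound_holds` — **J. A. Green's bound** `χ(1) ≤ 2^n p^{n(n-1)/2}` for every
  irreducible character of `GL_n(𝔽_p)` [cite: Macdonald1995, Ch. IV §6 (6.7)–(6.8); Green1955, Thm. 14]:
  the Harish-Chandra reduction `GreenGLnDegreeBound_of_cuspidal` (induction over maximal parabolics
  `P_{(k,m)}`, `[G : P] ψ_k ψ_m = ψ_{k+m}`) reduces it to `σ(1) p^m ≤ 2^m ψ_m(p)` for cuspidal `σ`,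
  which follows from `σ(1) ≤ ψ_{m-1}(p)` and `p^m ≤ 2^m (p^m - 1)`.

## References

* I. G. Macdonald, *Symmetric Functions and Hall Polynomials*, 2nd ed., Ch. IV §6 [Macdonald1995].
* J. A. Green, *The characters of the finite general linear groups*, TAMS 80 (1955) [Green1955].
* S. I. Gelfand, *Representations of the full linear group over a finite field*, Mat. Sb. 83 (1970).
-/

noncomputable section

open scoped BigOperators
open Module

namespace Literature.RepresentationTheory.FiniteGroups

namespace GLn

variable {F : Type} [Field F] [Fintype F] [DecidableEq F]

/-- **Cuspidal degrees** (S. I. Gelfand 1970; Bernstein–Zelevinsky): a cuspidal irreducible character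
`σ` of `GL_m(𝔽_q)`, `m ≥ 1`, has degree `σ(1) ≤ ∏_{i=1}^{m-1} (q^i - 1)` (given a non-trivial additive
character `ψ₀` of `𝔽_q`). [folklore] -/
theorem cuspidal_degree_le (ψ₀ : AddChar F ℂ) (hψ₀ : ψ₀ ≠ 1) {m : ℕ} (hm : 1 ≤ m)
    {σ : GL (Fin m) F → ℂ} (hσ : IsCuspidal F m σ) :
    ∃ d : ℕ, σ 1 = d ∧ d ≤ ∏ i ∈ Finset.range (m - 1), (Fintype.card F ^ (i + 1) - 1) := by
  have hirr : IsIrrChar (GL (Fin m) F) σ := hσ.1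
  obtain ⟨V, _, _, _, ρ, hρ, hchar⟩ := hirr
  have hcusp := hσ.2
  rw [← hchar] at hcusp
  have hdim := finrank_eq_prod_mul_finrank_whittaker ψ₀ ρ hψ₀ hm hcusp
  have hwh := finrank_whittaker_tailGroup_le_one ψ₀ hψ₀ ρ hρ
  refine ⟨finrank ℂ V, by rw [← hchar, Representation.char_one], ?_⟩
  calc finrank ℂ V = (∏ i ∈ Finset.range (m - 1), (Fintype.card F ^ (i + 1) - 1)) * _ := hdim
    _ ≤ (∏ i ∈ Finset.range (m - 1), (Fintype.card F ^ (i + 1) - 1)) * 1 := Nat.mul_le_mul_left _ hwh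
    _ = _ := mul_one _

end GLn

/-- `p^m ≤ 2^m (p^m - 1)` for `p ≥ 2`, `m ≥ 1`. [folklore] -/
theorem pow_le_two_pow_mul_pow_sub_one {p m : ℕ} (hp : 2 ≤ p) (hm : 1 ≤ m) :
    p ^ m ≤ 2 ^ m * (p ^ m - 1) := by
  have h2 : 2 ≤ 2 ^ m := by
    calc 2 = 2 ^ 1 := (pow_one 2).symm
      _ ≤ 2 ^ m := Nat.pow_le_pow_right (by norm_num) hm
  have hpm : 2 ^ m ≤ p ^ m := Nat.pow_le_pow_left hp m
  have hsum : p ^ m + 2 ^ m ≤ 2 ^ m * p ^ m := by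
    calc p ^ m + 2 ^ m ≤ p ^ m + p ^ m := Nat.add_le_add_left hpm _
      _ = 2 * p ^ m := by ring
      _ ≤ 2 ^ m * p ^ m := Nat.mul_le_mul_right _ h2
  rw [Nat.mul_sub_one]
  omega

/-- The standard additive character `e(x/p)` of `ZMod p` is non-trivial for a prime `p`. [folklore] -/
theorem stdAddChar_ne_one (p : ℕ) [Fact p.Prime] : (ZMod.stdAddChar : AddChar (ZMod p) ℂ) ≠ 1 := by
  rw [AddChar.ne_one_iff]
  refine ⟨1, fun h => ?_⟩
  have h0 : (ZMod.stdAddChar : AddChar (ZMod p) ℂ) 0 = 1 := AddChar.map_zero_eq_one _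
  have := ZMod.injective_stdAddChar (N := p) (h.trans h0.symm)
  exact one_ne_zero this

/-- **The cuspidal input of the Harish-Chandra reduction**: `σ(1) p^m ≤ 2^m ψ_m(p)` for every cuspidal
irreducible character `σ` of `GL_m(𝔽_p)`. [folklore] -/
theorem cuspidal_degree_mul_pow_le (p : ℕ) [Fact p.Prime] (m : ℕ) (hm : 1 ≤ m)
    (σ : GL (Fin m) (ZMod p) → ℂ) (hσ : GLn.IsCuspidal (ZMod p) m σ) :
    ∃ d : ℕ, σ 1 = d ∧ d * p ^ m ≤ 2 ^ m * ∏ i ∈ Finset.range m, (p ^ (i + 1) - 1) := by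
  obtain ⟨d, hd, hle⟩ := GLn.cuspidal_degree_le (ZMod.stdAddChar (N := p)) (stdAddChar_ne_one p) hm hσ
  rw [ZMod.card] at hle
  refine ⟨d, hd, ?_⟩
  have hp : 2 ≤ p := (Fact.out : p.Prime).two_le
  obtain ⟨m', rfl⟩ : ∃ m', m = m' + 1 := ⟨m - 1, by omega⟩
  rw [Nat.add_sub_cancel] at hle
  rw [Finset.prod_range_succ]
  calc d * p ^ (m' + 1) ≤ (∏ i ∈ Finset.range m', (p ^ (i + 1) - 1)) * p ^ (m' + 1) :=
        Nat.mul_le_mul_right _ hle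
    _ ≤ (∏ i ∈ Finset.range m', (p ^ (i + 1) - 1)) * (2 ^ (m' + 1) * (p ^ (m' + 1) - 1)) :=
        Nat.mul_le_mul_left _ (pow_le_two_pow_mul_pow_sub_one hp (Nat.succ_pos m'))
    _ = 2 ^ (m' + 1) * ((∏ i ∈ Finset.range m', (p ^ (i + 1) - 1)) * (p ^ (m' + 1) - 1)) := mul_left_comm _ _ _

/-- **J. A. Green's degree bound for `GL_n(𝔽_p)`** [cite: Macdonald1995, Ch. IV §6 (6.7)]: every
irreducible complex character `χ` of `GL_n(𝔽_p)` satisfies `χ(1) ≤ 2^n p^{n(n-1)/2}`.  Proof: the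
Harish-Chandra / parabolic-induction reduction `GreenGLnDegreeBound_of_cuspidal` plus the cuspidal
degree bound `cuspidal_degree_mul_pow_le` (Kirillov recursion and Gelfand–Graev multiplicity one).
[cite: Macdonald1995, Ch. IV §6 (6.7)–(6.8)] -/
theorem GreenGLnDegreeBound_holds : GreenGLnDegreeBound :=
  GreenGLnDegreeBound_of_cuspidal fun p _ m hm σ hσ => cuspidal_degree_mul_pow_le p m hm σ hσ

end Literature.RepresentationTheory.FiniteGroups

end
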